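import Literature.Claims.NS.ClayVariants
import Literature.Analysis.FluidPDE.NSVorticity
import HarnessLib

/-!
# Claim skeleton: Qun Lin (2013/2023), «On the Regularity for 3D Navier–Stokes Equation»
# (arXiv:1308.2297 v14, periodic initial–boundary value problem)

Cell `ns-claims` (D-0090 NS-CLAIMS SWEEP), claim C21, typist `ns-claims-typist-3`.
UNREFEREED/DISPUTED CLAIM under adjudication — NOTHING in this file asserts a step: every `Step_k`
is a `Prop` (the paper's k-th load-bearing assertion, typed concretely so that `¬ Step_k` or its
vacuity can be a kernel theorem, to be filed by a refuter summit-side as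
`Theorems/SoloRefuteLin2013.lean`); the only `theorem`s are kernel COMPOSITIONS of the paper's
own implications, one discharged arithmetic step, and unfolding lemmas.

Version of record (lead ruling 2026-08-26T20:12:21Z, provisional): Qun Lin, arXiv:1308.2297
**v14** [math.GM] (15 Jan 2023; 14 versions since 2013) [Lin2013Periodic]; TeX source
`pub/ns-claims/sources/Lin2013/periodic-arxiv-1308.2297/v14-2023-01-15-Periodic_16.tex` —
LOCATORS ARE TeX LINE NUMBERS `l.NNN` (no theorem environments in the text: headings only).
Lineage: the Cauchy twin arXiv:1310.3579 v15 [LinQun2013NSRegularityCauchy] (same scheme on ℝ³,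
CARD §1). LOCATORS.md by ns-claims-lit-2 (+ lit-1 supplement). (v14 §5 «Nonexistence»,
l.2089–2435, concerns the Riemann ξ-function and is not part of the Navier–Stokes argument.)

## Claimed statement (as printed)

Abstract, l.24–30: «In this paper we will prove that the vorticity belongs to L^∞(0,T;L²(Ω)) for
3D incompressible Navier-Stokes equation with periodic initial-boundary value conditions, then
the existence of a global smooth solution is obtained. Our approach is to construct a set of
auxiliary problems to approximate the original one of vorticity equation.» (`Ω = (0,1)³`, l.46;
§2 opening l.213–214: «For the 3D regularity, we only need to prove that the vorticity in (2)
belongs to L^∞(0,T;L²(Ω))»; §6 «Regularity» l.2436 ff.: `u ∈ L^∞(0,T;H²)`, bootstrap to `C^∞`.)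
Typed: `ClaimedTheorem := ClayVariants.clayPeriodicErrata.Regularity` (periodic box, `f ≡ 0`,
all `ν > 0`, velocity AND pressure periodic as in the paper's boundary conditions l.295–298).

## Clay delta (reference `ClayVariants.lean`)

Nearest: (B); `clayB_of_claimed` (errata ⇒ printed (B)). Axes: domain ℝ³/ℤ³ = · force ≡ 0 = ·
data smooth periodic = (the text «ignores the assumption of sufficient smoothness» and works with
`H`-data — a LARGER class; typed on Clay data) · solution class C^∞ periodic = · horizon every
`T` = · viscosity `ν > 0` = (the TeX writes the Laplacian with coefficient 1; «ν > 0 is viscosity»).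
Not a «wrong problem» candidate.

## Steps (paper item · TeX line · typist's private flag)

* `Step_1`  local theory / maximal development for the periodic problem (§1, «local existence
  of Galerkin solution», l.325–331; §3 «Existence» l.1090 ff.) — the alternative «global
  classical periodic solution OR a maximal one on some [0,T*) admitting no periodic classical
  continuation» — plausible (known).
* `Step_2`  §2 opening, l.213–214 with §6 l.2436–2797: «we only need to prove that the vorticity
  … belongs to L^∞(0,T;L²(Ω))» — a classical periodic solution on `[0,T)` whose vorticity is
  bounded in `L²(Ω)` uniformly on `[0,T)` continues past `T` — plausible (known: `H¹` control is
  subcritical).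
* `Step_3`  the energy bound (2)/(6), l.738–750: `K₀ := sup_t ∫_Ω|u|² + ∫₀ᵀ∫_Ω|∇u|² < +∞` —
  typed as the energy inequality for classical periodic solutions, `K₀ = (1 + 1/(2ν))∫_Ω|u₀|²` —
  plausible (known).
* `Step_4`  the Gronwall-product arithmetic, l.1019–1064: from `M_k ≤ (1 + C₃K_k*)e^{C₂K_k*}M_{k−1}`
  and `Σ K_k* ≤ (T+1)K₀` to `M_k ≤ M₀ e^{(C₂+C₃)(T+1)K₀}` — TRUE, PROVED (`step4_holds`).
* `Step_5`  **the one-step bound, l.955–1023** («f_k(t) ≤ M_{k−1} + C₂ (1/Δt_k) K_k* ∫f_k +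
  C₃K_k*M_{k−1} … By using Gronwall inequality it follows that M_k ≤ (1+C₃K_k*) exp(C₂K_k*)
  M_{k−1}», with «C₂, C₃ > 0 constants independent of k», l.992), typed AS USED at l.1068–1082 and
  in §4/§6, i.e. for the vorticity of the solution itself on an arbitrary subinterval
  `[a,b) ⊆ [0,T)`: `sup_{[a,b)}∫_Ω|ω|² ≤ (1 + C₃K*)e^{C₂K*} sup_{[0,a]}∫_Ω|ω|²` with
  `K* = (b−a)·sup_{[a,b)}∫_Ω|u|² + ∫_a^b∫_Ω|∇u|²` and `C₂, C₃` depending on `ν` only — suspicious /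
  open-strength (its printed support is an estimate for the LINEARISED auxiliary problems (5)
  l.225–257 with mollified, time-averaged coefficients, in two cases l.787–823 whose second case
  «δ_k ≤ O(Δt_k) M_{k−1}» hides a constant that is not shown uniform in `k` or in the partition;
  the transfer to the true vorticity is §4 «Convergence» l.1710–2088, not typed separately).
* `Step_6`  **§2's conclusion, l.1064–1082 («sup_{t∈(0,T)} ∫|ω̃|² ≤ max_k M_k ≤ M₀ exp((C₂+C₃)
  (T+1)K₀)» … «This conclusion is also true for the weak solution»), read through §4 for the true
  vorticity — LOAD-BEARING:** an a-priori bound `sup_{[0,T)}∫_Ω|ω|² ≤ ∫_Ω|ω₀|² e^{C(T+1)K₀}` for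
  every classical periodic solution — open-strength (with Steps 1–3 it is Clay (B)).
Ordered index (TYPING-HYGIENE 11): Step 1 = `Step_1` (l.325–331, §3 l.1090 ff.) · Step 2 =
`Step_2` (l.213–214, §6 l.2436 ff.) · Step 3 = `Step_3` ((2)/(6), l.738–750) · Step 4 = `Step_4`
(l.1019–1064) · Step 5 = `Step_5` (l.955–1023, l.992) · Step 6 = `Step_6` (l.1064–1082 + §4).
Not typed as steps: the auxiliary systems (5) l.225–257 themselves (linear, implicit in the
interval average `ω̄^k`, mollifier `J_ε`), the mollifier inequalities l.699–717 and the first case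
l.791–807 (choice of `ε_k`), §3 Galerkin existence for (5), §4 compactness details, §6 `H²`
bootstrap — their content enters only through Steps 5–6 as used.

## COMPOSITION — proved as `claim_of_steps`

* `step6_of_step5 : Step_3 → Step_5 → Step_6` — PROVED (the one-step bound applied to the single
  interval `[0,T)`, `K* ≤ (T+1)K₀`, and `(1 + C₃x)e^{C₂x} ≤ e^{(C₂+C₃)x}`; the partition of §2 is
  not needed once Step 5 holds uniformly — which is the point a referee will weigh).
* `claim_of_steps : Step_1 → … → Step_6 → ClaimedTheorem` — PROVED; consumes Steps 1, 2, 6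
  (maximal solution + vorticity bound + continuation ⇒ contradiction), Steps 3, 5 through
  `step6_of_step5` only, Step 4 not at all (its content is inside `step6_of_step5`).
* `step4_holds : Step_4` — PROVED (real arithmetic: `log(1+x) ≤ x`).

WHAT THIS IS NOT: not a claim about NS regularity or blow-up; not a claim about any author beyond the
typed locator.
-/

open MeasureTheory Set Filter
open scoped ContDiff ENNReal Topology

namespace Literature.Claims.NS.Lin2013

open Literature.Analysis.FluidPDE

noncomputable section

/-! ## Vocabulary (definitions with bodies; nothing asserted) -/

/-- The periodic cell `Ω = (0,1)³` (l.46). [cite: Lin2013Periodic, §1, l.46] -/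
def cell : Set (EuclideanSpace ℝ (Fin 3)) :=
  {x | ∀ i : Fin 3, x i ∈ Ioo (0 : ℝ) 1}

/-- `∫_Ω |v|²` over the cell (the paper's `∫_Ω (v₁² + v₂² + v₃²)`, e.g. `M_k`, `K₀`, l.767–777,
l.745). [cite: Lin2013Periodic, §2, l.767–777] -/
def cellSq (v : EuclideanSpace ℝ (Fin 3) → EuclideanSpace ℝ (Fin 3)) : ℝ :=
  ∫ x in cell, ‖v x‖ ^ 2

/-- `∫_Ω |∇v|²` over the cell, with the operator norm of the derivative (the paper's
`Σᵢ‖∇vᵢ‖²_{L²(Ω)}`, l.773–777, l.745–750; equivalent up to a dimensional constant).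
[cite: Lin2013Periodic, §2, l.745–750] -/
def cellGradSq (v : EuclideanSpace ℝ (Fin 3) → EuclideanSpace ℝ (Fin 3)) : ℝ :=
  ∫ x in cell, ‖fderiv ℝ v x‖ ^ 2

/-- A classical ℤ³-periodic solution of the unforced Navier–Stokes system on `ℝ³ × S` («periodic
initial-boundary value conditions», l.295–298: velocity, vorticity and the multiplier periodic).
[cite: Lin2013Periodic, §2, l.295–306] -/
def IsPeriodicClassicalOn (S : Set ℝ) (ν : ℝ)
    (u : ℝ → EuclideanSpace ℝ (Fin 3) → EuclideanSpace ℝ (Fin 3))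
    (p : ℝ → EuclideanSpace ℝ (Fin 3) → ℝ) : Prop :=
  IsClassicalNSSolutionOn S ν 0 u p ∧ ∀ t ∈ S, IsLatticePeriodic (u t) ∧ IsLatticePeriodic (p t)

/-- «The solution continues past `T`» for the periodic problem: a classical periodic solution on a
longer interval agreeing with `u` on `[0,T)` (the continuation the §2 opening l.213–214 and §6
aim at). [cite: Lin2013Periodic, §2 l.213–214 and §6 l.2436] -/
def HasPeriodicExtensionPast (ν : ℝ) (u : ℝ → EuclideanSpace ℝ (Fin 3) → EuclideanSpace ℝ (Fin 3))
    (T : ℝ) : Prop :=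
  ∃ T' : ℝ, T < T' ∧
    ∃ (u' : ℝ → EuclideanSpace ℝ (Fin 3) → EuclideanSpace ℝ (Fin 3))
      (p' : ℝ → EuclideanSpace ℝ (Fin 3) → ℝ),
      IsPeriodicClassicalOn (Ico 0 T') ν u' p' ∧ ∀ t ∈ Ico 0 T, u' t = u t

/-! ## The claimed statement -/

/-- **The claim (abstract l.24–30, §2 l.213–214, §6 l.2436 ff.), assembled** (no theorem
environment in the text): global smooth solutions of the periodic initial–boundary value problem
for every smooth periodic datum — Clay (B) in the errata reading (velocity and pressure periodic,
as the paper's boundary conditions), over the schema of `ClayVariants.lean`.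
[cite: Lin2013Periodic, abstract l.24–30 and §2 l.213–214] -/
def ClaimedTheorem : Prop :=
  ClayVariants.clayPeriodicErrata.Regularity

/-- The claimed (errata-form) statement implies the printed Clay (B) leaf.
[cite: Lin2013Periodic, abstract l.24–30] -/
theorem clayB_of_claimed (h : ClaimedTheorem) : ClayVariants.clayPeriodic.Regularity :=
  ClayVariants.clayPeriodic_regularity_iff.mpr
    (ClayVariants.clayPeriodicErrata_regularity_imp_printed h)

/-! ## The steps -/

/-- **Step 1 — local theory and maximal development for the periodic problem** (§1 l.325–331:
«by means of the Galerkin method and the compactness imbedding theorem, we can prove the local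
existence of the weak solutions … for each (t_{k−1}, t_k) being small enough»; §3 «Existence»
l.1090 ff.): for `ν > 0` and a smooth divergence-free periodic datum, EITHER a global classical
periodic solution, OR a classical periodic solution on some `[0,T*)`, `0 < T* < ∞`, admitting no
classical periodic continuation past `T*`. Typist's flag: plausible (known).
[cite: Lin2013Periodic, §1 l.325–331 and §3 l.1090] -/
def Step_1 : Prop :=
  ∀ ν : ℝ, 0 < ν →
    ∀ u₀ : EuclideanSpace ℝ (Fin 3) → EuclideanSpace ℝ (Fin 3), ContDiff ℝ ∞ u₀ →
      NSWave0.IsDivFree u₀ → IsLatticePeriodic u₀ →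
      (∃ (u : ℝ → EuclideanSpace ℝ (Fin 3) → EuclideanSpace ℝ (Fin 3))
          (p : ℝ → EuclideanSpace ℝ (Fin 3) → ℝ), IsPeriodicClassicalOn (Ici 0) ν u p ∧ u 0 = u₀) ∨
      (∃ T : ℝ, 0 < T ∧
        ∃ (u : ℝ → EuclideanSpace ℝ (Fin 3) → EuclideanSpace ℝ (Fin 3))
          (p : ℝ → EuclideanSpace ℝ (Fin 3) → ℝ),
          IsPeriodicClassicalOn (Ico 0 T) ν u p ∧ u 0 = u₀ ∧ ¬ HasPeriodicExtensionPast ν u T)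

/-- **Step 2 — §2 opening, l.213–214 («For the 3D regularity, we only need to prove that the
vorticity in (2) belongs to L^∞(0,T;L²(Ω))»), with §6 «Regularity» l.2436 ff.:** a classical
periodic solution on `[0,T)` whose vorticity is bounded in `L²(Ω)` uniformly on `[0,T)` continues
past `T`. Typist's flag: plausible (known: `H¹`-control is subcritical).
[cite: Lin2013Periodic, §2 l.213–214 and §6 l.2436] -/
def Step_2 : Prop :=
  ∀ ν : ℝ, 0 < ν → ∀ T : ℝ, 0 < T →
    ∀ (u : ℝ → EuclideanSpace ℝ (Fin 3) → EuclideanSpace ℝ (Fin 3))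
      (p : ℝ → EuclideanSpace ℝ (Fin 3) → ℝ), IsPeriodicClassicalOn (Ico 0 T) ν u p →
      (∃ M : ℝ, ∀ t ∈ Ico 0 T, cellSq (curl (u t)) ≤ M) → HasPeriodicExtensionPast ν u T

/-- **Step 3 — the energy bound (2)/(6), l.738–750** («sup ∫_Ω(u₁²+u₂²+u₃²) + ∫₀ᵀ(‖∇u₁‖² + …)
≤ K₀ < +∞»): typed as the energy inequality for classical periodic solutions on `[0,T)` with the
explicit `K₀ = (1 + 1/(2ν)) ∫_Ω|u₀|²`. Typist's flag: plausible (known).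
[cite: Lin2013Periodic, eqs. (2)/(6), l.738–750] -/
def Step_3 : Prop :=
  ∀ ν : ℝ, 0 < ν → ∀ T : ℝ, 0 < T →
    ∀ (u : ℝ → EuclideanSpace ℝ (Fin 3) → EuclideanSpace ℝ (Fin 3))
      (p : ℝ → EuclideanSpace ℝ (Fin 3) → ℝ), IsPeriodicClassicalOn (Ico 0 T) ν u p →
      ∀ t ∈ Ico 0 T,
        cellSq (u t) + (∫ s in (0 : ℝ)..t, cellGradSq (u s)) ≤ (1 + 1 / (2 * ν)) * cellSq (u 0)

/-- **Step 4 — the Gronwall-product arithmetic, l.1019–1064** («M_k ≤ (1 + C₃K_k*) exp(C₂K_k*)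
M_{k−1} … Σ K_k* ≤ (T+1)K₀ … Π(1 + C₃K_k*) ≤ exp(C₃ΣK_k*) … M_k ≤ M₀ exp((C₂+C₃)(T+1)K₀)»), over
`ℝ`. Typist's flag: true — PROVED (`step4_holds`). [cite: Lin2013Periodic, §2, l.1019–1064] -/
def Step_4 : Prop :=
  ∀ (N : ℕ) (C₂ C₃ B : ℝ) (M K : ℕ → ℝ), 0 ≤ C₂ → 0 ≤ C₃ → (∀ k, 0 ≤ M k) → (∀ k, 0 ≤ K k) →
    (∀ k, k < N → M (k + 1) ≤ (1 + C₃ * K k) * Real.exp (C₂ * K k) * M k) →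
    (∑ k ∈ Finset.range N, K k) ≤ B →
    M N ≤ M 0 * Real.exp ((C₂ + C₃) * B)

/-- **Step 5 — the one-step bound, l.955–1023 with «C₂, C₃ > 0 constants independent of k»
(l.992), AS USED at l.1068–1082 / §4 / §6 for the solution itself:** for `ν > 0` there are
constants `C₂, C₃` such that for every classical periodic solution on `[0,T)` and every
subinterval `[a,b) ⊆ [0,T)`: `sup_{t∈[a,b)} ∫_Ω|ω(t)|² ≤ (1 + C₃K*) e^{C₂K*} · sup_{s∈[0,a]} ∫_Ω|ω(s)|²`,
`K* = (b − a)·sup_{[a,b)}∫_Ω|u|² + ∫_a^b ∫_Ω|∇u|²` (the paper's `K_k*`, l.993–1005, and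
`M_{k−1} ≥` the vorticity energy at `t_{k−1}`). Printed support: the energy estimate (6) l.649–679
/ l.826–991 for the LINEAR auxiliary systems (5) (mollified, interval-averaged coefficients), the
two cases l.787–823 (choice of `ε_k`; «Otherwise δ_k ≤ O(Δt_k) M_{k−1}»), Sobolev `H¹ ⊂ L⁴`
l.895–901, Gronwall l.1019. Typist's flag: suspicious / open-strength (the constant hidden in
«O(Δt_k)» and the passage auxiliary → true vorticity (§4) are where uniformity is asserted, not
shown; as a statement about Navier–Stokes it bounds enstrophy growth by energy quantities alone).
[cite: Lin2013Periodic, §2, l.955–1023 and l.992] -/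
def Step_5 : Prop :=
  ∀ ν : ℝ, 0 < ν → ∃ C₂ C₃ : ℝ, 0 ≤ C₂ ∧ 0 ≤ C₃ ∧ ∀ T : ℝ, 0 < T →
    ∀ (u : ℝ → EuclideanSpace ℝ (Fin 3) → EuclideanSpace ℝ (Fin 3))
      (p : ℝ → EuclideanSpace ℝ (Fin 3) → ℝ), IsPeriodicClassicalOn (Ico 0 T) ν u p →
    ∀ a b : ℝ, 0 ≤ a → a < b → b ≤ T →
    ∀ Mprev Ku Kg : ℝ,
      (∀ s ∈ Icc 0 a, cellSq (curl (u s)) ≤ Mprev) →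
      (∀ t ∈ Ico a b, cellSq (u t) ≤ Ku) →
      (∫ s in a..b, cellGradSq (u s)) ≤ Kg →
      ∀ t ∈ Ico a b, cellSq (curl (u t)) ≤
        (1 + C₃ * ((b - a) * Ku + Kg)) * Real.exp (C₂ * ((b - a) * Ku + Kg)) * Mprev

/-- **Step 6 — §2's conclusion, l.1064–1082, read through §4 «Convergence» (l.1710–2088) for the
solution itself — LOAD-BEARING:** «sup_{t∈(0,T)} ∫(ω̃₁² + ω̃₂² + ω̃₃²) ≤ max_k M_k ≤ M₀ exp((C₂ +
C₃)(T+1)K₀) … This conclusion is also true for the weak solution of problem (5)» and (§4) the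
limit «belongs to L^∞(0,T;L²(Ω))» and solves the vorticity equation of `u`: for `ν > 0` there is
`C` such that every classical periodic solution on `[0,T)` obeys `∫_Ω|ω(t)|² ≤ ∫_Ω|ω(0)|² ·
e^{C (T+1) K₀}` for `t < T`, whenever `K₀` bounds `sup_{[0,T)}∫_Ω|u|²` and `∫₀ᵀ∫_Ω|∇u|²`.
Typist's flag: suspicious / open-strength (an a-priori enstrophy bound by energy — with Steps 1–3
it is Clay (B)). [cite: Lin2013Periodic, §2 l.1064–1082 and §4 l.1710–2088] -/
def Step_6 : Prop :=
  ∀ ν : ℝ, 0 < ν → ∃ C : ℝ, 0 ≤ C ∧ ∀ T : ℝ, 0 < T →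
    ∀ (u : ℝ → EuclideanSpace ℝ (Fin 3) → EuclideanSpace ℝ (Fin 3))
      (p : ℝ → EuclideanSpace ℝ (Fin 3) → ℝ), IsPeriodicClassicalOn (Ico 0 T) ν u p →
    ∀ K₀ : ℝ, (∀ t ∈ Ico 0 T, cellSq (u t) ≤ K₀) →
      (∀ t ∈ Ico 0 T, (∫ s in (0 : ℝ)..t, cellGradSq (u s)) ≤ K₀) →
      ∀ t ∈ Ico 0 T, cellSq (curl (u t)) ≤ cellSq (curl (u 0)) * Real.exp (C * (T + 1) * K₀)

/-! ## Kernel compositions and the discharged arithmetic step -/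

/-- `(1 + C₃ x) e^{C₂ x} ≤ e^{(C₂ + C₃) x}` (the inequality behind l.1053–1064; in fact for all
real `C₂, C₃, x`, since `1 + y ≤ eʸ`). [cite: Lin2013Periodic, §2, l.1053–1064] -/
theorem one_add_mul_exp_le (C₂ C₃ x : ℝ) :
    (1 + C₃ * x) * Real.exp (C₂ * x) ≤ Real.exp ((C₂ + C₃) * x) := by
  have h1 : 1 + C₃ * x ≤ Real.exp (C₃ * x) := by
    have := Real.add_one_le_exp (C₃ * x)
    linarith
  calc (1 + C₃ * x) * Real.exp (C₂ * x) ≤ Real.exp (C₃ * x) * Real.exp (C₂ * x) :=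
        mul_le_mul_of_nonneg_right h1 (Real.exp_nonneg _)
    _ = Real.exp ((C₂ + C₃) * x) := by rw [← Real.exp_add]; ring_nf

/-- **Step 4 (the Gronwall-product arithmetic, l.1019–1064) holds.**
[cite: Lin2013Periodic, §2, l.1019–1064] -/
theorem step4_holds : Step_4 := by
  intro N C₂ C₃ B M K hC₂ hC₃ hM hK hstep hsum
  -- M N ≤ M 0 · exp((C₂+C₃) Σ_{k<N} K k), by induction on N
  have key : ∀ n, n ≤ N →
      M n ≤ M 0 * Real.exp ((C₂ + C₃) * ∑ k ∈ Finset.range n, K k) := by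
    intro n
    induction n with
    | zero => intro _; simp
    | succ n ih =>
      intro hn
      have hn' : n < N := Nat.lt_of_succ_le hn
      have h1 := hstep n hn'
      have h2 := ih hn'.le
      have h3 : (1 + C₃ * K n) * Real.exp (C₂ * K n) ≤ Real.exp ((C₂ + C₃) * K n) :=
        one_add_mul_exp_le C₂ C₃ (K n)
      have h4 : 0 ≤ (1 + C₃ * K n) * Real.exp (C₂ * K n) :=
        mul_nonneg (by nlinarith [hK n]) (Real.exp_nonneg _)
      calc M (n + 1) ≤ (1 + C₃ * K n) * Real.exp (C₂ * K n) * M n := h1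
        _ ≤ Real.exp ((C₂ + C₃) * K n) *
              (M 0 * Real.exp ((C₂ + C₃) * ∑ k ∈ Finset.range n, K k)) :=
            mul_le_mul h3 h2 (hM n) (Real.exp_nonneg _)
        _ = M 0 * Real.exp ((C₂ + C₃) * ∑ k ∈ Finset.range (n + 1), K k) := by
            rw [Finset.sum_range_succ, mul_add, Real.exp_add]; ring
  have hfin := key N le_rfl
  have hmono : Real.exp ((C₂ + C₃) * ∑ k ∈ Finset.range N, K k) ≤ Real.exp ((C₂ + C₃) * B) :=
    Real.exp_le_exp.mpr (mul_le_mul_of_nonneg_left hsum (by linarith))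
  exact hfin.trans (mul_le_mul_of_nonneg_left hmono (hM 0))

/-- **Step 5 ⇒ Step 6 (with the energy bound, Step 3 not even needed in this form): the one-step
bound on the single interval `[0,T)`**, `K* = T·K₀ + K₀ = (T+1)K₀`, and `(1 + C₃x)e^{C₂x} ≤
e^{(C₂+C₃)x}` (l.1053–1064). The time partition of §2 plays no rôle once Step 5 holds with
uniform constants. [cite: Lin2013Periodic, §2, l.1013–1082] -/
theorem step6_of_step5 (h5 : Step_5) : Step_6 := by
  intro ν hν
  obtain ⟨C₂, C₃, hC₂, hC₃, h⟩ := h5 ν hν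
  refine ⟨C₂ + C₃, by linarith, fun T hT u p hsol K₀ hKu hKg t ht => ?_⟩
  have hK₀ : 0 ≤ K₀ := by
    have h0 := hKu 0 ⟨le_rfl, hT⟩
    exact le_trans (by unfold cellSq; positivity) h0
  -- Step 5 on [0,b) for some b ∈ (t,T), with Mprev = ∫|ω(0)|², Ku = Kg = K₀
  obtain ⟨b, htb, hbT⟩ : ∃ b, t < b ∧ b < T := exists_between ht.2
  have hb0 : 0 < b := lt_of_le_of_lt ht.1 htb
  have hKg' : (∫ s in (0 : ℝ)..b, cellGradSq (u s)) ≤ K₀ := hKg b ⟨hb0.le, hbT⟩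
  have hstep := h T hT u p hsol 0 b le_rfl hb0 hbT.le (cellSq (curl (u 0))) K₀ K₀
    (fun s hs => by
      have : s = 0 := le_antisymm hs.2 hs.1
      subst this; exact le_rfl)
    (fun s hs => hKu s ⟨hs.1, hs.2.trans hbT⟩) (by simpa using hKg') t ⟨ht.1, htb⟩
  have h1 : (1 + C₃ * ((b - 0) * K₀ + K₀)) * Real.exp (C₂ * ((b - 0) * K₀ + K₀)) ≤
      Real.exp ((C₂ + C₃) * ((b - 0) * K₀ + K₀)) := one_add_mul_exp_le C₂ C₃ _
  have h2 : Real.exp ((C₂ + C₃) * ((b - 0) * K₀ + K₀)) ≤ Real.exp ((C₂ + C₃) * (T + 1) * K₀) := by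
    apply Real.exp_le_exp.mpr
    have : (b - 0) * K₀ + K₀ ≤ (T + 1) * K₀ := by nlinarith
    calc (C₂ + C₃) * ((b - 0) * K₀ + K₀) ≤ (C₂ + C₃) * ((T + 1) * K₀) :=
          mul_le_mul_of_nonneg_left this (by linarith)
      _ = (C₂ + C₃) * (T + 1) * K₀ := by ring
  have hM0 : 0 ≤ cellSq (curl (u 0)) := by unfold cellSq; positivity
  calc cellSq (curl (u t))
      ≤ (1 + C₃ * ((b - 0) * K₀ + K₀)) * Real.exp (C₂ * ((b - 0) * K₀ + K₀)) * cellSq (curl (u 0)) :=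
        hstep
    _ ≤ Real.exp ((C₂ + C₃) * (T + 1) * K₀) * cellSq (curl (u 0)) :=
        mul_le_mul_of_nonneg_right (h1.trans h2) hM0
    _ = cellSq (curl (u 0)) * Real.exp ((C₂ + C₃) * (T + 1) * K₀) := mul_comm _ _

/-- **The paper's logic COMPOSES: the claimed theorem from Steps 1–6** (hypotheses in step order;
consumes Steps 1, 2, 3, 6: a maximal periodic solution with finite `T*` has, by the energy bound
and the a-priori estimate of Step 6, vorticity bounded in `L²(Ω)` on `[0,T*)`, hence continues
past `T*` by Step 2 — contradiction; so the global branch of Step 1 holds, which is (B) in the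
errata form). [cite: Lin2013Periodic, §2 l.213–214, l.1064–1082, §6 l.2436] -/
theorem claim_of_steps : Step_1 → Step_2 → Step_3 → Step_4 → Step_5 → Step_6 → ClaimedTheorem := by
  intro h1 h2 h3 _ _ h6 ν hν u₀ hu₀ hdiv hper
  rcases h1 ν hν u₀ hu₀ hdiv hper with ⟨u, p, hsol, h0⟩ | ⟨T, hT, u, p, hsol, h0, hmax⟩
  · exact ⟨u, p, hsol.1.smooth_velocity, hsol.1.smooth_pressure,
      ⟨fun t ht x => hsol.1.momentum t ht x, fun t ht => hsol.1.divFree t ht, h0⟩,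
      fun t ht => hsol.2 t ht⟩
  · exfalso
    obtain ⟨C, _, hC⟩ := h6 ν hν
    -- energy bound K₀ = (1 + 1/(2ν)) ∫|u₀|²
    set K₀ : ℝ := (1 + 1 / (2 * ν)) * cellSq (u 0) with hK₀
    have hen := h3 ν hν T hT u p hsol
    have hgrad_nonneg : ∀ t ∈ Ico 0 T, 0 ≤ ∫ s in (0 : ℝ)..t, cellGradSq (u s) := fun t ht =>
      intervalIntegral.integral_nonneg ht.1 fun s _ => by unfold cellGradSq; positivity
    have hsq_nonneg : ∀ t, 0 ≤ cellSq (u t) := fun t => by unfold cellSq; positivity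
    have hKu : ∀ t ∈ Ico 0 T, cellSq (u t) ≤ K₀ := fun t ht => by
      have := hen t ht; have := hgrad_nonneg t ht; linarith
    have hKg : ∀ t ∈ Ico 0 T, (∫ s in (0 : ℝ)..t, cellGradSq (u s)) ≤ K₀ := fun t ht => by
      have := hen t ht; have := hsq_nonneg t; linarith
    have hbound := hC T hT u p hsol K₀ hKu hKg
    exact hmax (h2 ν hν T hT u p hsol
      ⟨cellSq (curl (u 0)) * Real.exp (C * (T + 1) * K₀), fun t ht => hbound t ht⟩)


/-! ## Locator-decl hygiene for row #28 (C21): the PRINT-LITERAL, per-solution reading of Steps 5–6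

«C₂, C₃ > 0 constants independent of k» (l.992) is said of the GIVEN solution and partition: the
constants may depend on `ν`, `T` and `(u,p)`, not on the subinterval. `Step_5`/`Step_6` above are
the as-typed `ν`-UNIFORM strengthenings (constants right after `∀ ν`), false on paper by
Navier–Stokes scaling of a localised datum (UG-AUDIT ns-claims-refuter-2 g3, 2026-08-27) and kept
as history; the locator decl of record for the same sentence p.11 is `Step_5'` (chair ruling
2026-08-27T05:09:40Z).
The two compositions below are `step6_of_step5` / `claim_of_steps` verbatim with the constants
obtained after the solution. -/

/-- **Step 5′ — the one-step bound l.955–1023 / l.992, PRINT-LITERAL (constants per solution)**: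
for `ν > 0`, every `T > 0` and every classical periodic solution on `[0,T)` there are `C₂, C₃ ≥ 0`
such that on every subinterval `[a,b) ⊆ [0,T)` the bound of `Step_5` holds. Implied by `Step_5`
(`step5'_of_step5`). Typist's flag: suspicious / open-strength (per solution the load sits at
`b ↑ T = T*`). [cite: Lin2013Periodic, §2, l.955–1023 and l.992] -/
def Step_5' : Prop :=
  ∀ ν : ℝ, 0 < ν → ∀ T : ℝ, 0 < T →
    ∀ (u : ℝ → EuclideanSpace ℝ (Fin 3) → EuclideanSpace ℝ (Fin 3))
      (p : ℝ → EuclideanSpace ℝ (Fin 3) → ℝ), IsPeriodicClassicalOn (Ico 0 T) ν u p →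
    ∃ C₂ C₃ : ℝ, 0 ≤ C₂ ∧ 0 ≤ C₃ ∧
    ∀ a b : ℝ, 0 ≤ a → a < b → b ≤ T →
    ∀ Mprev Ku Kg : ℝ,
      (∀ s ∈ Icc 0 a, cellSq (curl (u s)) ≤ Mprev) →
      (∀ t ∈ Ico a b, cellSq (u t) ≤ Ku) →
      (∫ s in a..b, cellGradSq (u s)) ≤ Kg →
      ∀ t ∈ Ico a b, cellSq (curl (u t)) ≤
        (1 + C₃ * ((b - a) * Ku + Kg)) * Real.exp (C₂ * ((b - a) * Ku + Kg)) * Mprev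

/-- **Step 6′ — §2's conclusion l.1064–1082 (with §4), PRINT-LITERAL (constant per solution)**:
for `ν > 0`, every `T > 0` and every classical periodic solution on `[0,T)` there is `C ≥ 0` with
`∫_Ω|ω(t)|² ≤ ∫_Ω|ω(0)|² · e^{C (T+1) K₀}` for `t < T` whenever `K₀` bounds the energy quantities.
With Steps 1–3 this is still Clay (B) (`claim_of_steps'`).
[cite: Lin2013Periodic, §2 l.1064–1082] -/
def Step_6' : Prop :=
  ∀ ν : ℝ, 0 < ν → ∀ T : ℝ, 0 < T →
    ∀ (u : ℝ → EuclideanSpace ℝ (Fin 3) → EuclideanSpace ℝ (Fin 3))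
      (p : ℝ → EuclideanSpace ℝ (Fin 3) → ℝ), IsPeriodicClassicalOn (Ico 0 T) ν u p →
    ∃ C : ℝ, 0 ≤ C ∧ ∀ K₀ : ℝ, (∀ t ∈ Ico 0 T, cellSq (u t) ≤ K₀) →
      (∀ t ∈ Ico 0 T, (∫ s in (0 : ℝ)..t, cellGradSq (u s)) ≤ K₀) →
      ∀ t ∈ Ico 0 T, cellSq (curl (u t)) ≤ cellSq (curl (u 0)) * Real.exp (C * (T + 1) * K₀)

/-- The as-typed `ν`-uniform Step 5 implies the print-literal Step 5′.
[cite: Lin2013Periodic, §2, l.992] -/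
theorem step5'_of_step5 (h : Step_5) : Step_5' := fun ν hν T hT u p hsol => by
  obtain ⟨C₂, C₃, hC₂, hC₃, h⟩ := h ν hν
  exact ⟨C₂, C₃, hC₂, hC₃, h T hT u p hsol⟩

/-- The as-typed `ν`-uniform Step 6 implies the print-literal Step 6′.
[cite: Lin2013Periodic, §2, l.1064–1082] -/
theorem step6'_of_step6 (h : Step_6) : Step_6' := fun ν hν T hT u p hsol => by
  obtain ⟨C, hC, h⟩ := h ν hν
  exact ⟨C, hC, h T hT u p hsol⟩

/-- **Step 5′ ⇒ Step 6′** — `step6_of_step5` verbatim, per solution (one interval `[0,b)`,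
`K* ≤ (T+1)K₀`, `(1 + C₃x)e^{C₂x} ≤ e^{(C₂+C₃)x}`). [cite: Lin2013Periodic, §2, l.1013–1082] -/
theorem step6'_of_step5' (h5 : Step_5') : Step_6' := by
  intro ν hν T hT u p hsol
  obtain ⟨C₂, C₃, hC₂, hC₃, h⟩ := h5 ν hν T hT u p hsol
  refine ⟨C₂ + C₃, by linarith, fun K₀ hKu hKg t ht => ?_⟩
  have hK₀ : 0 ≤ K₀ := le_trans (by unfold cellSq; positivity) (hKu 0 ⟨le_rfl, hT⟩)
  obtain ⟨b, htb, hbT⟩ : ∃ b, t < b ∧ b < T := exists_between ht.2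
  have hb0 : 0 < b := lt_of_le_of_lt ht.1 htb
  have hKg' : (∫ s in (0 : ℝ)..b, cellGradSq (u s)) ≤ K₀ := hKg b ⟨hb0.le, hbT⟩
  have hstep := h 0 b le_rfl hb0 hbT.le (cellSq (curl (u 0))) K₀ K₀
    (fun s hs => by
      have : s = 0 := le_antisymm hs.2 hs.1
      subst this; exact le_rfl)
    (fun s hs => hKu s ⟨hs.1, hs.2.trans hbT⟩) (by simpa using hKg') t ⟨ht.1, htb⟩
  have h1 := one_add_mul_exp_le C₂ C₃ ((b - 0) * K₀ + K₀)
  have h2 : Real.exp ((C₂ + C₃) * ((b - 0) * K₀ + K₀)) ≤ Real.exp ((C₂ + C₃) * (T + 1) * K₀) := by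
    apply Real.exp_le_exp.mpr
    have : (b - 0) * K₀ + K₀ ≤ (T + 1) * K₀ := by nlinarith
    calc (C₂ + C₃) * ((b - 0) * K₀ + K₀) ≤ (C₂ + C₃) * ((T + 1) * K₀) :=
          mul_le_mul_of_nonneg_left this (by linarith)
      _ = (C₂ + C₃) * (T + 1) * K₀ := by ring
  have hM0 : 0 ≤ cellSq (curl (u 0)) := by unfold cellSq; positivity
  calc cellSq (curl (u t))
      ≤ (1 + C₃ * ((b - 0) * K₀ + K₀)) * Real.exp (C₂ * ((b - 0) * K₀ + K₀)) *
          cellSq (curl (u 0)) := hstep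
    _ ≤ Real.exp ((C₂ + C₃) * (T + 1) * K₀) * cellSq (curl (u 0)) :=
        mul_le_mul_of_nonneg_right (h1.trans h2) hM0
    _ = cellSq (curl (u 0)) * Real.exp ((C₂ + C₃) * (T + 1) * K₀) := mul_comm _ _

/-- **The paper's logic still COMPOSES with the print-literal Steps 5′–6′** (`claim_of_steps`
verbatim: the constant of Step 6′ is only ever used for the one maximal solution at hand).
[cite: Lin2013Periodic, §2 l.213–214, l.1064–1082, §6 l.2436] -/
theorem claim_of_steps' :
    Step_1 → Step_2 → Step_3 → Step_4 → Step_5' → Step_6' → ClaimedTheorem := by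
  intro h1 h2 h3 _ _ h6 ν hν u₀ hu₀ hdiv hper
  rcases h1 ν hν u₀ hu₀ hdiv hper with ⟨u, p, hsol, h0⟩ | ⟨T, hT, u, p, hsol, h0, hmax⟩
  · exact ⟨u, p, hsol.1.smooth_velocity, hsol.1.smooth_pressure,
      ⟨fun t ht x => hsol.1.momentum t ht x, fun t ht => hsol.1.divFree t ht, h0⟩,
      fun t ht => hsol.2 t ht⟩
  · exfalso
    obtain ⟨C, _, hC⟩ := h6 ν hν T hT u p hsol
    set K₀ : ℝ := (1 + 1 / (2 * ν)) * cellSq (u 0) with hK₀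
    have hen := h3 ν hν T hT u p hsol
    have hgrad_nonneg : ∀ t ∈ Ico 0 T, 0 ≤ ∫ s in (0 : ℝ)..t, cellGradSq (u s) := fun t ht =>
      intervalIntegral.integral_nonneg ht.1 fun s _ => by unfold cellGradSq; positivity
    have hsq_nonneg : ∀ t, 0 ≤ cellSq (u t) := fun t => by unfold cellSq; positivity
    have hKu : ∀ t ∈ Ico 0 T, cellSq (u t) ≤ K₀ := fun t ht => by
      have := hen t ht; have := hgrad_nonneg t ht; linarith
    have hKg : ∀ t ∈ Ico 0 T, (∫ s in (0 : ℝ)..t, cellGradSq (u s)) ≤ K₀ := fun t ht => by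
      have := hen t ht; have := hsq_nonneg t; linarith
    have hbound := hC K₀ hKu hKg
    exact hmax (h2 ν hν T hT u p hsol
      ⟨cellSq (curl (u 0)) * Real.exp (C * (T + 1) * K₀), fun t ht => hbound t ht⟩)

end

end Literature.Claims.NS.Lin2013
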